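import Literature.MathematicalPhysics.QuantumFieldTheory.Balaban1983to89.B11Thm1ExistsUniqueStepTokensG

/-!
# `Balaban1983to89.B11Thm1ExistsUniqueInductionG` — [Balaban1985Variational] = «[15]», Theorem 1 p. 279 (existence ∕ uniqueness half): PRINT'S INDUCTION ON THE LENGTH `k` AS A
# PROVED THEOREM — the guard-generic (E∕U) name `B11Thm1ExistsUniqueCoP7MG.VariationalThm1EUSepTop7MG` from the ONE-LENGTH STEP TOKEN, K0's (R)-name, the supply token AT LENGTH 1,
# and a LIFT TOKEN for (11)–(13), over r11's (2.18) index TRUNCATED BY ONE LENGTH (`truncSeq`)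

Honest framing: statement-level skeleton of published theorems with citation tags; proofs where landed; nothing here is a claim about the Yang–Mills mass gap.  Cell `pub-ymgap`
(HUMAN RULINGS D-0062 ∕ D-0149), lane `pub-ymgap-dag-n12-c` g33 (R134 seat (a), N12 = [B15], s1); `--kind definition --supports` K1⁹ `stmt-QuantumFields-27364`; count-neutral; N12 NOT
discharged; finite 𝕋⁴ at fixed ε; nothing continuum ∕ ℝ⁴ ∕ OS ∕ mass-gap ∕ Clay.  ONE data definition (`truncSeq`), ONE named `Prop` (the lift token, NEVER asserted) + its
`CoP` edition and `Iff.rfl`; no theorem, no `sorry`, no `instance`.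

THE PRINT ([15] pp. 279–280).  *«Theorem 1 will be proved by induction with respect to k. … The first step of the proof, for k = 1, will be covered by the proof of a general case.
A. A Reduction of the Proof of Theorem 1.  We start a proof of Theorem 1 for some k assuming that it is true for k − 1. We have a configuration V defined on 𝔅_k and satisfying (7). The
set 𝔅_k determines the following set 𝔅′_{k−1} = ⋃_{j=0}^{k−1} Λ′_j, Λ′_j = Λ_j for j = 0, 1, …, k − 2, Λ′_{k−1} = Λ_{k−1} ∪ B(Λ_k). We can easily construct a configuration V₀ on 𝔅′_{k−1}
such that it satisfies (7) on 𝔅′_{k−1}, and V₀ = V on ⋃_{j<k} Λ_j, V̄₀ = V on Λ_k. (11) … we apply the Theorem 1 for k − 1 and the configuration V₀. We get a minimal configuration U₀ =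
U_{k−1}(V₀) belonging to the space U_{k−1}({Ω_j}, B₃ε₁) ∩ 𝔘_{k−1}(𝔅′_{k−1}, V₀). (12) From the conditions (11), and from the form (2) of the regularity conditions, it follows that U₀ ∈
U_k({Ω_j}, B₃L³ε₁) ∩ 𝔘_k(𝔅_k, V), (13)»* — i.e. `U₀` satisfies (14) with `C₁ = L³`, and the one-length analysis (Prop. 2 + Sects. B–E = the step token) concludes.

THE TRUNCATION IN THE TREE.  r11's (2.18) index `B14.Eq218Concrete.Seq D k` normalises `Ω_j = Λ_j = ∅` off the window `1 ≤ j ≤ k`, and the determining set `genSet Ω k` ∕ the class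
ranges `Sect2.omegaPlaqsTop Ω Ω₀ n`, `Sect2.omegaBondsTop Ω Ω₀ n` read `Ω_1, …, Ω_k` only; so dropping the last domain (`truncSeq s`, §1: `ofChain` of the (2.1) chain restricted to
`j ≤ k`) gives EXACTLY print's `𝔅′_{k−1}`: `(truncSeq s).Ω j = s.Ω j` for `j ≤ k` (`truncSeq_Ω_of_le`), `= ∅` above (`truncSeq_Ω_of_lt`), hence `Γ′_k = Ω_k ⊇ Λ_k ∪ Ω_{k+1}`
(`gammaRegion_self`), `Γ′_j = Γ_j` below, the class ranges at the scales `≤ k` UNCHANGED, separation inherited (Bridges: `seqSeparated_truncSeq`).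

CONTENTS (THIS FILE STAYS STATEMENT-ONLY: one data `def`, one named `Prop` + its `CoP` edition, one `Iff.rfl`; the lemmas and the PROVED induction live in the sibling THEOREMS-ONLY
module `B11Thm1ExistsUniqueInductionGBridges`).
* §1 `truncSeq s` — r11's index truncated by one length (print's `𝔅′_{k−1}`).  Lemmas (`truncSeq_Ω_of_le ∕ _of_lt`, `truncSeq_Λ_of_le`, `seqSeparated_truncSeq`,
  `floorGuard_truncSeq`) in the Bridges module.
* §2 ★ THE LIFT TOKEN `VariationalThm1EULiftTop7MG F N Sup Adm C₁ B₃ a₀ a₁` ∕ `…LiftCoP7MG` (a `Prop` with parameters, NEVER asserted): at an index `s` of length `k+1 ≥ 2` under the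
  name's binders, for every datum `W` with (7) THERE ARE thresholds `ε₀′, δ′` in the name's numeric range and a datum `V₀` with (7) for the TRUNCATED problem ((11)) such that every
  `B₃δ′`-REGULAR MINIMISER of the truncated problem with datum `V₀` is an approximate minimiser with (14) at length `k+1` for `W` at the thresholds `C₁B₃δ_n` ((12)–(13)).  In the tree's
  `bondsOf`-MEETING convention this contains the interface-solvability statement (ℓ2) of the token module's docstring.  [15] (11)–(13); NO producer in the tree.
* Bridges module §2: ★★★ `variationalThm1EUSepTop7MG_of_step_of_reg_of_base_of_lift` ∕ `…CoP7MG…` — PRINT'S INDUCTION, PROVED: the (E∕U) name from (i) the one-length step token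
  `VariationalThm1EUStepTop7MG … C₁ …`, (ii) K0's (R)-name `Node00.VariationalThm1RegSepTop7MG` (the regularity (12) of the truncated minimiser), (iii) the supply token AT LENGTH 1 ONLY
  — the guard-generic supply token under the guard `Adm ∧ (k = 1)` (print: *«for k = 1 … we take simply U₀ = V₀»*), (iv) the lift token, (v) truncation-stability of the guard
  (`Adm … (k+1) s → Adm … k (truncSeq s)`; automatic for K0's floor ∕ level ∕ divisibility guards, `floorGuard_truncSeq`); by induction on the length, the induction hypothesis applied to
  `(truncSeq s, V₀, ε₀′, δ′)`.  ONE constant `C₁` is shared by the step token and the lift token — print's `C₁ = L³` ((13)); since the chart's smallness `ε₂ ≤ B₁(ε₀ + C₁ε₁)` (p. 281)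
  grows with `C₁`, the ceilings `a₀, a₁` at which a producer inhabits the step token are those of THAT `C₁` (node00-def-RR-2 READ-634 NOTE-b): instantiate at `C₁ := (F.L)^3`, never
  «for all `C₁`» at fixed ceilings.

HONEST SCOPE.  One more NAMED `Prop` (never asserted) and a by-name induction between named `Prop`s none of which is produced in the tree (producers: [15] Props 2–7 for the step token —
N07; (11)–(13) + interface solvability for the lift and the length-1 supply — NODE 00 ∕ N07); nothing of Bałaban's analysis asserted or proved; count-neutral; K0⁷ ∕ K1⁹ NOT closed; N12
NOT discharged; the YM mass gap (Clay) is NOT proved by any of this.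

References: [15] Thm 1 p.279, (11) p.279, (12)–(14) p.280, Prop. 2 p.281; [6] = [Balaban1985RegularSpaces] (1.3)–(1.9) p.77; [III] = [Balaban1988Convergent] (2.1) p.254, (2.2)
p.255, (2.12) p.256, (2.18) p.257; [I] = [Balaban1987RG1] (0.1) p.251.
-/

noncomputable section

namespace Literature.MathematicalPhysics.QuantumFieldTheory.Balaban1983to89.B11Thm1ExistsUniqueInductionG

open T4Continuum B15DeterminingSets GaugeField Node00
open B16Sect1Backgrounds (toMS)
open B14.Eq218Concrete (Seq)
open B11Thm1ExistsUniqueCoP7MG (VariationalThm1EUSepTop7MG VariationalThm1EUSepCoP7MG)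
open B11Thm1ExistsUniqueStepTokensG (ApproxMinTop VariationalThm1EUStepTop7MG VariationalThm1EUStepCoP7MG ApproxMinimiserExistsTop7MG ApproxMinimiserExistsCoP7MG)

/-! ## §1  r11's (2.18) index truncated by one length (print's `𝔅′_{k−1}`) -/

section Trunc

variable {α : Type*} {D : ℕ → Set (Set α)} {k : ℕ}

/-- **PRINT'S TRUNCATED PROBLEM `𝔅′_{k−1}`** ([15] p. 279, before (11): *«Λ′_j = Λ_j for j = 0, 1, …, k − 2, Λ′_{k−1} = Λ_{k−1} ∪ B(Λ_k)»*) for r11's (2.18) index: the SAME domains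
`Ω_j, Λ_j` on the window `1 ≤ j ≤ k`, the last pair `(Ω_{k+1}, Λ_{k+1})` DROPPED (normalised to `∅`); the (2.1) chain letters are inherited. [cite: Balaban1985Variational, (11) p.279; Balaban1988Convergent, (2.1) p.254, (2.18) p.257] -/
def truncSeq (s : Seq D (k + 1)) : Seq D k :=
  Seq.ofChain s.Ω s.Λ
    { memΩ := fun j h1 hj => s.chain.memΩ j h1 (hj.trans (Nat.le_succ k))
      memΛ := fun j h1 hj => s.chain.memΛ j h1 (hj.trans (Nat.le_succ k))
      Λ_subset := fun j h1 hj => s.chain.Λ_subset j h1 (hj.trans (Nat.le_succ k))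
      Ω_succ_subset := fun j h1 hj => s.chain.Ω_succ_subset j h1 (Nat.lt_succ_of_lt hj) }

end Trunc

/-! ## §2  The lift token ([15] (11)–(13)) -/

section Lift

variable (F : T4Family) (N : ℕ) [NeZero N]

/-- **★ NAMED TOKEN — PRINT'S LIFT (11)–(13) ALONG THE TRUNCATION** (a `Prop` with parameters, NEVER asserted; guard-generic, top-domain selector `Sup`): at an index `s` of length
`k + 1` with `0 < k` under the binders of `VariationalThm1EUSepTop7MG` (separated, `0 < ν.M₁`, guard at `(k+1, s)`, thresholds `δ_n` in the numeric range at `(B₃, a₀, a₁, ε₀)`, datum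
`W` with (7) on the support), THERE EXIST thresholds `ε₀′ ≤ a₀`, `δ′` (positive, `≤ a₁`, `B₃δ′_n ≤ ε₀′`, comparable both ways, on the window `n ≤ k`) and a datum `V₀` with (7) for the
TRUNCATED problem `(truncSeq s, k)` — print's (11) *«We can easily construct a configuration V₀ on 𝔅′_{k−1} such that it satisfies (7) on 𝔅′_{k−1}, and V₀ = V on ⋃_{j<k} Λ_j, V̄₀ =
V on Λ_k»* — such that EVERY minimiser of the truncated problem over the class (6) at `ε₀′` with the data `V₀` which is `B₃δ′`-regular in the sense of (8) is an APPROXIMATE MINIMISER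
with (14) for `(s, W)` at length `k + 1` at the thresholds `C₁B₃δ_n` — print's (12)–(13) (`C₁ = L³`: the scale-`k` regularity of the truncated minimiser on `Ω_k ⊇ Ω_{k+1}` read at
scale `k+1`, `η_k = L·η_{k+1}`, `δ′_k ≤ 2δ_{k+1}`).  In the tree's `bondsOf`-MEETING convention the agreement half of (14) at the bonds sticking out of `Ω_{k+1}` is an
interface-solvability demand on the design of `V₀` (token module, docstring (ℓ2)).  NO producer in the tree.
-- TODO(general form): print's (11)–(13) for general admissible `{Ω_j}`; print's constraint convention «U_j = V on Λ_j» has no sticking-out bonds.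
[cite: Balaban1985Variational, (11) p.279, (12)–(14) p.280, (2)–(7) p.278; Balaban1985RegularSpaces, (1.3)–(1.9) p.77; Balaban1988Convergent, (2.1) p.254, (2.2) p.255, (2.10)–(2.12) p.256, (2.18) p.257] -/
def VariationalThm1EULiftTop7MG (Sup : (ν : Stage7Numerics) → (K : ℕ) → (ℕ → Set (Site (F.P K) 0)) → Set (Site (F.P K) 0)) (Adm : StepGuard F) (C₁ B₃ a₀ a₁ : ℝ) :
    Prop :=
  ∀ (ν : Stage7Numerics) (M : ℕ) (g : ℕ → ℝ) (K k : ℕ) (s : SeqOfRecord F ν M g K (k + 1)), 0 < k → Sect2.SeqSeparated ν.M₁ s → 0 < ν.M₁ → Adm ν M g K (k + 1) s →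
    ∀ (ε₀ : ℝ) (δ : ℕ → ℝ),
    (∀ n, n ≤ k + 1 → 0 < δ n ∧ δ n ≤ a₁ ∧ B₃ * δ n ≤ ε₀) → (∀ n, n < k + 1 → δ n ≤ 2 * δ (n + 1)) → (∀ n, n < k + 1 → δ (n + 1) ≤ 2 * δ n) → ε₀ ≤ a₀ →
    ∀ W : MSField (F.P K) (SU N), Sect2.DataSmall7PTop (avOfRecord F N K) s.Ω (Sup ν K s.Ω) (k + 1) δ W →
      ∃ (ε₀' : ℝ) (δ' : ℕ → ℝ) (V₀ : MSField (F.P K) (SU N)),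
        (∀ n, n ≤ k → 0 < δ' n ∧ δ' n ≤ a₁ ∧ B₃ * δ' n ≤ ε₀') ∧ (∀ n, n < k → δ' n ≤ 2 * δ' (n + 1)) ∧ (∀ n, n < k → δ' (n + 1) ≤ 2 * δ' n) ∧ ε₀' ≤ a₀ ∧
        Sect2.DataSmall7PTop (avOfRecord F N K) (truncSeq s).Ω (Sup ν K (truncSeq s).Ω) k δ' V₀ ∧
        ∀ U : GaugeField (F.P K) 0 (SU N),
          IsMinimizer (avOfRecord F N K)
              {U | (∀ n, n ≤ k → PlaqSmallOn (Sect2.omegaPlaqsTop (truncSeq s).Ω (Sup ν K (truncSeq s).Ω) n) (ε₀' * (F.P K).eta n ^ 2) U) ∧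
                Sect2.CoDivClassOnTop (truncSeq s).Ω (Sup ν K (truncSeq s).Ω) k ε₀' U} (genSet (truncSeq s).Ω k) V₀ U →
          ((∀ n, n ≤ k → PlaqSmallOn (Sect2.omegaPlaqsTop (truncSeq s).Ω (Sup ν K (truncSeq s).Ω) n) (B₃ * δ' n * (F.P K).eta n ^ 2) U) ∧
            ∀ n, n ≤ k → Sect2.CoDivSmallOn (Sect2.omegaBondsTop (truncSeq s).Ω (Sup ν K (truncSeq s).Ω) n) (B₃ * δ' n * (F.P K).eta n ^ 3) U) →
          ApproxMinTop (avOfRecord F N K) s.Ω (Sup ν K s.Ω) (k + 1) (fun n => C₁ * B₃ * δ n) W U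

/-- **★ NAMED TOKEN, `CoP` EDITION — PRINT'S LIFT (11)–(13) ON THE SUPPORT OF RECORD.** [cite: Balaban1985Variational, (11) p.279, (12)–(14) p.280; Balaban1988Convergent, p.255, (2.12) p.256] -/
def VariationalThm1EULiftCoP7MG (Adm : StepGuard F) (C₁ B₃ a₀ a₁ : ℝ) : Prop :=
  VariationalThm1EULiftTop7MG F N (fun ν K Ω => suppDomOfRecord F ν K Ω) Adm C₁ B₃ a₀ a₁

variable {F N}

/-- The `CoP` lift token IS the top-domain token at node00-def-R's selector (definitional). [cite: Balaban1985Variational, (11) p.279 (bookkeeping)] -/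
theorem variationalThm1EULiftCoP7MG_iff {Adm : StepGuard F} {C₁ B₃ a₀ a₁ : ℝ} :
    VariationalThm1EULiftCoP7MG F N Adm C₁ B₃ a₀ a₁ ↔ VariationalThm1EULiftTop7MG F N (fun ν K Ω => suppDomOfRecord F ν K Ω) Adm C₁ B₃ a₀ a₁ := Iff.rfl

end Lift


end Literature.MathematicalPhysics.QuantumFieldTheory.Balaban1983to89.B11Thm1ExistsUniqueInductionG

end
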